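import Literature.NumberTheory.EllipticCurves.PadicFiltrationIndexProofs
import Literature.NumberTheory.EllipticCurves.FormalGroupPadicLogPointProofs
import Summits.BirchSwinnertonDyer.Rank1Residual.X11b.AnticyclotomicLogWellDefined
import Summits.BirchSwinnertonDyer.Rank1Residual.X11b.LocalTorsionMultiplicative
import Summits.BirchSwinnertonDyer.Rank1Residual.X11b.ZpLineIndex
import HarnessLib

/-!
# Class X11b, routes p2/R1: the LOCAL INDEX at `p` — `[E(ℚ_p) : p^k E(ℚ_p) + ℤP] = p^{min(k, e)}`,
# `e = ord_p log_ω P + ord_p c_p + ord_p #Ẽ_ns(𝔽_p) − 1` under (iv) `E(ℚ_p)[p] = 0`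
# (cell `b2b-bsdres`, sub-cell `multr1-p2`, gen 15)

HONEST FRAMING (verbatim, cell `b2b-bsdres`): the goal of the cell is to DELETE the
COMBINATION-SHAPED residual classes for ALL analytic-rank `≤ 1` curves over `ℚ` — "full BSD
formula for every rank `≤ 1` curve in class `C`" assembled STRICTLY from published theorems — so
that the rank-`≤ 1` remainder becomes exactly the CONSTRUCTION-SHAPED classes, which are TYPED
(missing-input Props), NOT attempted; this is not "finishing BSD". Research route `p2` for class
X11b; no claim beyond the stated class; nothing booked; X11b stays CONSTRUCTION-SHAPED. Theorems only; no `sorry`; no named fact.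

## What this file proves

The "(calcul)" of Castella 2018 (proof of Thm. 2.3, arXiv:1704.06608 p. 6) / Jetchev–Skinner–Wan
2017 (7.1.5): `[E(K_𝔭)_{/tor} ⊗ ℤ_p : ℤ_p P] = #ℤ_p/((1/p)·(#Ẽ(𝔽_p)/... ) log_ω P) · …`, i.e. the
`p`-adic position of a global point inside `E(ℚ_p) ⊗ ℤ_p ≅ ℤ_p`, ON TREE OBJECTS and in the
finite-level form in which the Selmer-group count (JSW Prop. 3.2.1 / the route's input (d)
`P2SelmerCardBoundAt`) consumes it:

* §1 `norm_padicFormalLog_eq`: **`‖log_W(t)‖ = ‖t‖` for `‖t‖ ≤ p⁻²`** (`‖coeff n log_W‖ ≤ n`, AEC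
  IV.6.3(a)); hence on `E⁽²⁾(ℚ_p)` the formal logarithm `padicLogPoint` and the tree's limit
  logarithm `padicLimitLog` have the same absolute value / valuation
  (`norm_padicLogPoint_eq_norm_padicLimitLog`, `valuation_padicLogPoint_eq`).
* §5 for a `ℤ_p`-minimal `X/ℚ_p` with (iv): `exists_formalFiltration_two_addEquiv`
  (`E⁽²⁾(ℚ_p) ≃+ ℤ_p`, `P ↦ L(P)/p²`, the tree's construction with the map exposed),
  `index_formalFiltration_two` (`[E : E⁽²⁾] = p·[E : E⁽¹⁾]`), and
  **`index_range_nsmul_sup_zmultiples_eq_pow`**: for `Q` of infinite order and every `k`,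
  `[E(ℚ_p) : p^k E(ℚ_p) + ℤQ] = p^{min(k,e)}`,
  `e = (ord_p log_W z(m₁Q) − ord_p m₁) + ord_p c_p + ord_p #Ẽ_ns(𝔽_p) − 1`, `m₁ = [E(ℚ_p):E₁(ℚ_p)]`
  (the `ℤ_p`-line lemma `ZpLineIndex` with `E = E⁽²⁾`, `[E:E⁽²⁾] = c_p·#Ẽ_ns·p`).
* §6 for the globally minimal `W/ℚ`, an embedding `ι : K → ℚ_p` and `P ∈ E(K)` in the route's
  currency `padicLogOrd W p ι P = ord_p log_ω P` (`AnticyclotomicEmbedding`):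
  **`index_range_nsmul_sup_zmultiples_padicPointOf`** (`e = padicLogOrd + ord_p c_p + ord_p #Ẽ_ns − 1`)
  and at a MULTIPLICATIVE `p` (`#Ẽ_ns(𝔽_p) = p ∓ 1`, sibling `not_dvd_reductionPointCount_of_mult`)
  **`…_of_mult`: `e = padicLogOrd W p ι P + ord_p c_p − 1`**.

Under (iv) these indices are, for `k ≥ e`, exactly `p^e` with
`e = (ord_p log_ω P − 1) + ord_p c_p` — the exponent `(ord_p log_ω P − 1) − ord_p[E(K):ℤP] + ord_p c_p`
of `P2SelmerCardBoundAt` / `BaseSelmerCountAt` read at the generator `Q` of `E(K) ⊗ ℤ_p`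
(`P = I·Q`, `ord_p log_ω P = ord_p log_ω Q + ord_p I`). Nothing booked; labels unchanged.

References: [Castella2018] §2.2 and proof of Thm. 2.3 (arXiv:1704.06608 pp. 5–6);
[JetchevSkinnerWan2017] (7.1.5) (arXiv:1512.06894 p. 16); [SilvermanAEC2009] IV.3.2, IV.6.3–6.4,
VII.2.1–2.2, VII.6.1–6.3, Ex. 3.5.
-/

noncomputable section

open scoped Classical
open Filter PowerSeries Literature.NumberTheory.EllipticCurves
open scoped Topology

namespace Summit.BirchSwinnertonDyer.Rank1Residual.X11b.LocalIndex

variable {p : ℕ} [Fact p.Prime]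

/-! ## §1 `‖log_W(t)‖ = ‖t‖` for `‖t‖ ≤ p⁻²` -/

section LogNorm

variable (W : WeierstrassCurve ℚ_[p]) [hW : W.IsIntegral ℤ_[p]]

/-- `(n + 2) rⁿ ≤ 2` for `0 ≤ r ≤ 1/4`. [folklore] -/
private theorem aux_bound {r : ℝ} (hr0 : 0 ≤ r) (hr : r ≤ 1 / 4) (n : ℕ) :
    ((n : ℝ) + 2) * r ^ n ≤ 2 := by
  induction n with
  | zero => simp
  | succ n ih =>
    have h1 : ((n : ℝ) + 1 + 2) * r ^ (n + 1) = (((n : ℝ) + 3) * r) * r ^ n := by ring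
    rw [Nat.cast_succ, h1]
    have h2 : ((n : ℝ) + 3) * r ≤ (n : ℝ) + 2 := by nlinarith
    calc ((n : ℝ) + 3) * r * r ^ n ≤ ((n : ℝ) + 2) * r ^ n :=
          mul_le_mul_of_nonneg_right h2 (pow_nonneg hr0 n)
      _ ≤ 2 := ih

/-- **`‖log_W(t)‖_p = ‖t‖_p` for `‖t‖ ≤ p⁻²`** (`p`-integral `W`): `log_W(t) = t + Σ_{n≥2} cₙtⁿ` with
`‖cₙ‖ ≤ n` (AEC IV.6.3(a), tree `norm_coeff_formalLog_le`), and `n‖t‖ⁿ ≤ 2‖t‖² < ‖t‖` for `n ≥ 2`,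
`‖t‖ ≤ p⁻² ≤ 1/4`. (AEC IV.6.4(b): `log` is an isometry on `Ê(𝓜ʳ)`, `r` large.)
[cite: SilvermanAEC2009, IV.6.4(b)] -/
theorem norm_padicFormalLog_eq {t : ℚ_[p]} (ht : ‖t‖ ≤ ((p : ℝ)⁻¹) ^ 2) :
    ‖W.padicFormalLog t‖ = ‖t‖ := by
  have hp2 : (2 : ℝ) ≤ p := by exact_mod_cast (Fact.out : p.Prime).two_le
  have hpR : (0 : ℝ) < p := by linarith
  have hr4 : ((p : ℝ)⁻¹) ^ 2 ≤ 1 / 4 := by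
    rw [inv_pow, one_div]
    exact inv_anti₀ (by norm_num) (by nlinarith)
  set r := ‖t‖ with hr
  have hr0 : 0 ≤ r := norm_nonneg t
  have hr4' : r ≤ 1 / 4 := ht.trans hr4
  have hr1 : r < 1 := by linarith
  -- the summable series
  have hsum : Summable fun n : ℕ => coeff n W.formalLog * t ^ n := W.summable_formalLog_of_isIntegral t hr1
  -- split off the terms `n = 0, 1`
  have hsplit : W.padicFormalLog t = t + ∑' n : ℕ, coeff (n + 2) W.formalLog * t ^ (n + 2) := by
    rw [WeierstrassCurve.padicFormalLog, hsum.tsum_eq_zero_add,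
      (summable_nat_add_iff 1 |>.mpr hsum).tsum_eq_zero_add]
    simp only [zero_add, pow_zero, mul_one, pow_one, WeierstrassCurve.coeff_one_formalLog, one_mul]
    rw [show coeff 0 W.formalLog = 0 from by
      rw [PowerSeries.coeff_zero_eq_constantCoeff_apply]; exact W.constantCoeff_formalLog]
    ring_nf
  -- the tail is small
  have htail : ‖∑' n : ℕ, coeff (n + 2) W.formalLog * t ^ (n + 2)‖ ≤ 2 * r ^ 2 := by
    refine IsUltrametricDist.norm_tsum_le_of_forall_le_of_nonneg (by positivity) fun n => ?_
    rw [norm_mul, norm_pow]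
    calc ‖coeff (n + 2) W.formalLog‖ * r ^ (n + 2) ≤ ((n + 2 : ℕ) : ℝ) * r ^ (n + 2) :=
          mul_le_mul_of_nonneg_right (W.norm_coeff_formalLog_le (n + 2)) (pow_nonneg hr0 _)
      _ = (((n : ℝ) + 2) * r ^ n) * r ^ 2 := by push_cast; ring
      _ ≤ 2 * r ^ 2 := mul_le_mul_of_nonneg_right (aux_bound hr0 hr4' n) (pow_nonneg hr0 2)
  rcases eq_or_ne t 0 with rfl | ht0
  · -- `t = 0`
    have : (fun n : ℕ => coeff n W.formalLog * (0 : ℚ_[p]) ^ n) = fun n => if n = 0 then coeff 0 W.formalLog else 0 := by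
      ext n; rcases n with _ | n <;> simp
    rw [WeierstrassCurve.padicFormalLog, this, tsum_ite_eq]
    rw [PowerSeries.coeff_zero_eq_constantCoeff_apply, W.constantCoeff_formalLog, norm_zero, hr, norm_zero]
  · have hrpos : 0 < r := norm_pos_iff.mpr ht0
    have hlt : ‖∑' n : ℕ, coeff (n + 2) W.formalLog * t ^ (n + 2)‖ < ‖t‖ := by
      refine htail.trans_lt ?_
      rw [← hr]
      nlinarith
    rw [hsplit, IsUltrametricDist.norm_add_eq_max_of_norm_ne_norm (ne_of_gt hlt), max_eq_left hlt.le]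

/-- **`‖log_W z(P)‖ = ‖z(P)‖ = ‖L(P)‖` on `E⁽²⁾(ℚ_p)`**: the formal logarithm `padicLogPoint` and the
limit logarithm `padicLimitLog` have the same absolute value on `E⁽²⁾` (both equal `‖z(P)‖`:
`norm_padicFormalLog_eq`, tree `norm_padicLimitLog_of_mem`). [cite: SilvermanAEC2009, IV.6.4(b)] -/
theorem norm_padicLogPoint_eq_norm_padicLimitLog [W.IsElliptic] {P : W.toAffine.Point}
    (hP : P ∈ W.formalFiltration 2) : ‖W.padicLogPoint P‖ = ‖W.padicLimitLog P‖ := by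
  rw [W.norm_padicLimitLog_of_mem le_rfl hP, WeierstrassCurve.padicLogPoint,
    norm_padicFormalLog_eq W hP.2]

/-- On `E⁽²⁾(ℚ_p)`, `ord_p log_W z(P) = ord_p L(P)`. [cite: SilvermanAEC2009, IV.6.4(b)] -/
theorem valuation_padicLogPoint_eq [W.IsElliptic] {P : W.toAffine.Point}
    (hP : P ∈ W.formalFiltration 2) : (W.padicLogPoint P).valuation = (W.padicLimitLog P).valuation := by
  have h := norm_padicLogPoint_eq_norm_padicLimitLog W hP
  by_cases h0 : W.padicLimitLog P = 0
  · have : W.padicLogPoint P = 0 := by rwa [h0, norm_zero, norm_eq_zero] at h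
    rw [this, h0]
  · have h0' : W.padicLogPoint P ≠ 0 := by
      intro h1; rw [h1, norm_zero, eq_comm, norm_eq_zero] at h; exact h0 h
    rw [Padic.norm_eq_zpow_neg_valuation h0', Padic.norm_eq_zpow_neg_valuation h0] at h
    have hp1 : (1 : ℝ) < p := by exact_mod_cast (Fact.out : p.Prime).one_lt
    have := zpow_right_injective₀ (by positivity) hp1.ne' h
    linarith

end LogNorm

/-! ## §5 The local index on `E(ℚ_p)`: `[E(ℚ_p) : p^k E(ℚ_p) + ℤQ] = p^{min(k, e(Q))}`,
`e(Q) = ord_p log_ω Q + ord_p c_p + ord_p #Ẽ_ns(𝔽_p) − 1` -/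

section Curve

variable (X : WeierstrassCurve ℚ_[p]) [X.IsIntegral ℤ_[p]] [X.IsElliptic]

/-- **`E⁽²⁾(ℚ_p) ≃+ ℤ_p` through `P ↦ L(P)/p²`** — the tree's `nonempty_formalFiltration_addEquiv_padicInt`
with the map made explicit (same construction). [cite: SilvermanAEC2009, VII.6.3] -/
theorem exists_formalFiltration_two_addEquiv :
    ∃ φ : X.formalFiltration 2 ≃+ ℤ_[p],
      ∀ P : X.formalFiltration 2, ((φ P : ℤ_[p]) : ℚ_[p]) = X.padicLimitLog P / (p : ℚ_[p]) ^ 2 := by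
  have hp0 : (p : ℚ_[p]) ≠ 0 := Nat.cast_ne_zero.mpr (Fact.out : p.Prime).ne_zero
  have hpn : (p : ℚ_[p]) ^ 2 ≠ 0 := pow_ne_zero _ hp0
  have hpR : (0 : ℝ) < p := by exact_mod_cast (Fact.out : p.Prime).pos
  have hnorm : ∀ P : X.formalFiltration 2, ‖X.padicLimitLog P / (p : ℚ_[p]) ^ 2‖ ≤ 1 := by
    intro P
    rw [norm_div, norm_pow, Padic.norm_p, X.norm_padicLimitLog_of_mem le_rfl P.2,
      div_le_one (pow_pos (inv_pos.mpr hpR) _)]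
    exact P.2.2
  let φ : X.formalFiltration 2 →+ ℤ_[p] :=
    { toFun := fun P => ⟨X.padicLimitLog P / (p : ℚ_[p]) ^ 2, hnorm P⟩
      map_zero' := by
        apply PadicInt.ext
        show X.padicLimitLog (0 : X.toAffine.Point) / (p : ℚ_[p]) ^ 2 = 0
        rw [X.padicLimitLog_zero, zero_div]
      map_add' := fun P Q => by
        apply PadicInt.ext
        show X.padicLimitLog ((P : X.toAffine.Point) + Q) / (p : ℚ_[p]) ^ 2 =
          X.padicLimitLog (P : X.toAffine.Point) / (p : ℚ_[p]) ^ 2 +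
            X.padicLimitLog (Q : X.toAffine.Point) / (p : ℚ_[p]) ^ 2
        rw [X.padicLimitLog_add_of_mem le_rfl P.2 Q.2, add_div] }
  have hφ : ∀ P : X.formalFiltration 2, (φ P : ℚ_[p]) = X.padicLimitLog P / (p : ℚ_[p]) ^ 2 :=
    fun P => rfl
  refine ⟨AddEquiv.ofBijective φ ⟨?_, ?_⟩, fun P => hφ P⟩
  · rw [injective_iff_map_eq_zero]
    intro P hP
    have h0 : X.padicLimitLog P = 0 := by
      have := congrArg ((↑) : ℤ_[p] → ℚ_[p]) hP
      rw [hφ, PadicInt.coe_zero, div_eq_zero_iff] at this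
      exact this.resolve_right hpn
    exact Subtype.ext (X.eq_zero_of_padicLimitLog_eq_zero le_rfl P.2 h0)
  · intro t
    have ht : ‖(t : ℚ_[p]) * (p : ℚ_[p]) ^ 2‖ ≤ ((p : ℝ)⁻¹) ^ 2 := by
      rw [norm_mul, norm_pow, Padic.norm_p, inv_pow]
      calc ‖(t : ℚ_[p])‖ * ((p : ℝ) ^ 2)⁻¹ ≤ 1 * ((p : ℝ) ^ 2)⁻¹ :=
            mul_le_mul_of_nonneg_right t.2 (by positivity)
        _ = ((p : ℝ) ^ 2)⁻¹ := one_mul _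
    obtain ⟨Q, hQ, hLQ⟩ := X.exists_mem_padicLimitLog_eq le_rfl ht
    refine ⟨⟨Q, hQ⟩, PadicInt.ext ?_⟩
    rw [hφ]
    change X.padicLimitLog Q / (p : ℚ_[p]) ^ 2 = t
    rw [hLQ, mul_div_assoc, div_self hpn, mul_one]

variable [X.IsMinimal ℤ_[p]]

omit [X.IsMinimal ℤ_[p]] in
/-- `[E(ℚ_p) : E⁽²⁾(ℚ_p)] = p · [E(ℚ_p) : E⁽¹⁾(ℚ_p)]`. [cite: SilvermanAEC2009, IV.3.2(a) with VII.2.2] -/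
theorem index_formalFiltration_two :
    (X.formalFiltration 2).index = p * (X.formalFiltration 1).index := by
  haveI := X.finiteIndex_formalFiltration 1
  haveI := X.finiteIndex_formalFiltration 2
  rw [← AddSubgroup.relIndex_mul_index (X.formalFiltration_antitone (by norm_num : 1 ≤ 2)),
    X.relIndex_formalFiltration_succ le_rfl]

omit [X.IsMinimal ℤ_[p]] in
/-- `ord_p [E(ℚ_p) : E⁽¹⁾(ℚ_p)] = ord_p c_p + ord_p #Ẽ_ns(𝔽_p)` for a minimal equation
(`[E(ℚ_p) : E⁽¹⁾] = c_p · #Ẽ_ns(𝔽_p)`, tree `index_formalFiltration`). [cite: SilvermanAEC2009, VII.2.1 and VII.6.1] -/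
theorem padicValNat_index_formalFiltration_one [X.IsMinimal ℤ_[p]] :
    padicValNat p (X.formalFiltration 1).index =
      padicValNat p (X.localTamagawaNumber ℤ_[p]) +
        padicValNat p (Nat.card (X.reduction ℤ_[p]).toAffine.Point) := by
  rw [X.index_formalFiltration le_rfl, Nat.sub_self, pow_zero, mul_one]
  have h1 : X.localTamagawaNumber ℤ_[p] ≠ 0 := by
    intro h
    have := (X.finiteIndex_formalFiltration 1).index_ne_zero
    rw [X.index_formalFiltration le_rfl, h, zero_mul, zero_mul] at this
    exact this rfl
  have h2 : Nat.card (X.reduction ℤ_[p]).toAffine.Point ≠ 0 := by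
    intro h
    have := (X.finiteIndex_formalFiltration 1).index_ne_zero
    rw [X.index_formalFiltration le_rfl, h, mul_zero, zero_mul] at this
    exact this rfl
  exact padicValNat.mul h1 h2

/-- **THE LOCAL INDEX.** Let `X/ℚ_p` be a `ℤ_p`-minimal elliptic curve with `E(ℚ_p)[p] = 0`
((iv)), `Q ∈ E(ℚ_p)` of infinite order, `m₁ = [E(ℚ_p) : E₁(ℚ_p)]` (`= c_p · #Ẽ_ns(𝔽_p)`). Then for
every `k`,

  `[E(ℚ_p) : p^k E(ℚ_p) + ℤQ] = p^{min(k, e)}`,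
  `e = (ord_p log_W z(m₁Q) − ord_p m₁) + ord_p c_p + ord_p #Ẽ_ns(𝔽_p) − 1`

(`ord_p log_W z(m₁Q) − ord_p m₁ = ord_p log_ω Q` is Castella's / JSW's `ord_p log_{ω_E} Q`, the
`ℤ_p`-linear extension of the formal logarithm; at a multiplicative `p`, `#Ẽ_ns(𝔽_p) = p ∓ 1` is a
`p`-unit and `e = ord_p log_ω Q + ord_p c_p − 1`: the local index `#ℤ_p/((1/p)·log_ω Q) · c_p^{(p)}`
of Castella 2018 (calcul) / JSW17 (7.1.5) under (iv)).  Proof: `E(ℚ_p)/E(ℚ_p)_tors ≅ ℤ_p` by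
`Ψ(R) = L([E:E⁽²⁾]•R)/p²` (§4, `psi_surjective`), `[E(ℚ_p) : p^kE + ℤQ] = p^{min(k, v(Ψ Q))}`
(`index_range_nsmul_sup_zmultiples_eq`), `v(Ψ Q) = v(L(p m₁ Q)) − 2 = v(log_W z(p m₁ Q)) − 2 =
v(log_W z(m₁ Q)) − 1` (`‖log‖ = ‖L‖` on `E⁽²⁾`, additivity of `log_W z`).
[cite: Castella2018, proof of Thm. 2.3, (calcul) (arXiv:1704.06608 p. 6)]
[cite: JetchevSkinnerWan2017, (7.1.5) (arXiv:1512.06894 p. 16)] [cite: SilvermanAEC2009, IV.6.4, VII.6.3] -/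
theorem index_range_nsmul_sup_zmultiples_eq_pow (hiv : ∀ R : X.toAffine.Point, p • R = 0 → R = 0)
    (Q : X.toAffine.Point) (hQ : ¬ IsOfFinAddOrder Q) (k : ℕ) :
    ∃ e : ℕ, ((nsmulAddMonoidHom (p ^ k) : X.toAffine.Point →+ _).range ⊔
        AddSubgroup.zmultiples Q).index = p ^ min k e ∧
      (e : ℤ) = ((X.padicLogPoint ((X.formalFiltration 1).index • Q)).valuation -
          (padicValNat p (X.formalFiltration 1).index : ℤ)) +
        padicValNat p (X.localTamagawaNumber ℤ_[p]) +
          padicValNat p (Nat.card (X.reduction ℤ_[p]).toAffine.Point) - 1 := by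
  haveI := X.finiteIndex_formalFiltration 1
  haveI := X.finiteIndex_formalFiltration 2
  obtain ⟨φ, hφ⟩ := exists_formalFiltration_two_addEquiv X
  refine ⟨(psi (X.formalFiltration 2) φ Q).valuation,
    index_range_nsmul_sup_zmultiples_eq (X.formalFiltration 2) φ hiv Q hQ k, ?_⟩
  -- `Ψ Q = L(N₂ Q)/p²`, `N₂ Q ∈ E⁽²⁾`, `N₂ Q ≠ 0`
  have hmem : (X.formalFiltration 2).index • Q ∈ X.formalFiltration 2 :=
    (X.formalFiltration 2).nsmul_index_mem Q
  have hN₂ne : (X.formalFiltration 2).index • Q ≠ 0 := fun h ↦ hQ (isOfFinAddOrder_iff_nsmul_eq_zero.mpr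
    ⟨_, Nat.pos_of_ne_zero (X.finiteIndex_formalFiltration 2).index_ne_zero, h⟩)
  have hL0 : X.padicLimitLog ((X.formalFiltration 2).index • Q) ≠ 0 :=
    fun h ↦ hN₂ne (X.eq_zero_of_padicLimitLog_eq_zero le_rfl hmem h)
  have hp0 : (p : ℚ_[p]) ≠ 0 := Nat.cast_ne_zero.mpr (Fact.out : p.Prime).ne_zero
  have hpsi : ((psi (X.formalFiltration 2) φ Q : ℤ_[p]) : ℚ_[p]) =
      X.padicLimitLog ((X.formalFiltration 2).index • Q) / (p : ℚ_[p]) ^ 2 := by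
    rw [psi_apply]; exact hφ ⟨_, hmem⟩
  -- valuations
  have hv1 : ((psi (X.formalFiltration 2) φ Q).valuation : ℤ) =
      (X.padicLimitLog ((X.formalFiltration 2).index • Q)).valuation - 2 := by
    rw [← PadicInt.valuation_coe, hpsi, div_eq_mul_inv,
      Padic.valuation_mul hL0 (inv_ne_zero (pow_ne_zero _ hp0)), Padic.valuation_inv,
      Padic.valuation_pow, Padic.valuation_p]
    ring
  have hv2 : (X.padicLimitLog ((X.formalFiltration 2).index • Q)).valuation =
      (X.padicLogPoint ((X.formalFiltration 2).index • Q)).valuation :=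
    (valuation_padicLogPoint_eq X hmem).symm
  -- `N₂ = p m₁` and `log(N₂ Q) = p · log(m₁ Q)`
  have hN : (X.formalFiltration 2).index = p * (X.formalFiltration 1).index := index_formalFiltration_two X
  have hm₁mem : X.IsInReductionKernel ((X.formalFiltration 1).index • Q) :=
    ((X.formalFiltration 1).nsmul_index_mem Q).1
  have hlog : X.padicLogPoint ((X.formalFiltration 2).index • Q) =
      (p : ℚ_[p]) * X.padicLogPoint ((X.formalFiltration 1).index • Q) := by
    rw [hN, mul_nsmul']
    exact (padicLogPoint_nsmul X ((X.formalFiltration 1).index • Q) hm₁mem p).2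
  have hlog0 : X.padicLogPoint ((X.formalFiltration 2).index • Q) ≠ 0 := by
    intro h
    have h' := norm_padicLogPoint_eq_norm_padicLimitLog X hmem
    rw [h, norm_zero, eq_comm, norm_eq_zero] at h'
    exact hL0 h'
  have hlogm0 : X.padicLogPoint ((X.formalFiltration 1).index • Q) ≠ 0 := by
    intro h; rw [h, mul_zero] at hlog; exact hlog0 hlog
  have hv3 : (X.padicLogPoint ((X.formalFiltration 2).index • Q)).valuation =
      1 + (X.padicLogPoint ((X.formalFiltration 1).index • Q)).valuation := by
    rw [hlog, Padic.valuation_mul hp0 hlogm0, Padic.valuation_p]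
  rw [hv1, hv2, hv3, padicValNat_index_formalFiltration_one X]
  push_cast
  ring

end Curve

/-! ## §6 The local index at a degree-one prime for a curve over `ℚ`, in the route's currency `padicLogOrd` -/

section Global

open WeierstrassCurve Literature.NumberTheory.EllipticCurves.Rank1Residual

variable (W : WeierstrassCurve ℚ) [W.IsElliptic] [W.IsGloballyMinimal] (p : ℕ) [Fact p.Prime]
  {K : Type} [Field K] [NumberField K]

/-- **THE LOCAL INDEX IN THE ROUTE'S CURRENCY.** For the globally minimal `W/ℚ`, a prime `p` with
(iv) `E(ℚ_p)[p] = 0`, an embedding `ι : K → ℚ_p` and `P ∈ E(K)` whose image `P_ι ∈ E(ℚ_p)` has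
infinite order: for every `k`,
`[E(ℚ_p) : p^k E(ℚ_p) + ℤP_ι] = p^{min(k, e)}` with
`e = padicLogOrd W p ι P + ord_p c_p(E) + ord_p #Ẽ_ns(𝔽_p) − 1`
(`padicLogOrd = ord_p log_{ω_E} P`, `c_p = localTamagawaNumber` of the minimal model over `ℤ_p`,
`#Ẽ_ns(𝔽_p) = reductionPointCount W p`). [cite: Castella2018, proof of Thm. 2.3, (calcul) (arXiv:1704.06608 p. 6)]
[cite: JetchevSkinnerWan2017, (7.1.5) (arXiv:1512.06894 p. 16)] -/
theorem index_range_nsmul_sup_zmultiples_padicPointOf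
    (hiv : ∀ R : (W.baseChange ℚ_[p]).toAffine.Point, p • R = 0 → R = 0)
    (ι : K →+* ℚ_[p]) (P : (W.baseChange K).toAffine.Point)
    (hP : ¬ IsOfFinAddOrder (padicPointOf W p ι P)) (k : ℕ) :
    ∃ e : ℕ, ((nsmulAddMonoidHom (p ^ k) : (W.baseChange ℚ_[p]).toAffine.Point →+ _).range ⊔
        AddSubgroup.zmultiples (padicPointOf W p ι P)).index = p ^ min k e ∧
      (e : ℤ) = padicLogOrd W p ι P +
        padicValNat p ((W.baseChange ℚ_[p]).localTamagawaNumber ℤ_[p]) +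
          padicValNat p (reductionPointCount W p) - 1 := by
  obtain ⟨e, h1, h2⟩ :=
    index_range_nsmul_sup_zmultiples_eq_pow (W.baseChange ℚ_[p]) hiv (padicPointOf W p ι P) hP k
  refine ⟨e, h1, ?_⟩
  rw [h2, LocalTorsion.natCard_point_reduction_baseChange_padic W p]
  rfl

/-- **At a MULTIPLICATIVE `p`**: `#Ẽ_ns(𝔽_p) = p ∓ 1` is a `p`-unit
(`LocalTorsion.not_dvd_reductionPointCount_of_mult`), so
`[E(ℚ_p) : p^k E(ℚ_p) + ℤP_ι] = p^{min(k, e)}` with `e = padicLogOrd W p ι P + ord_p c_p(E) − 1` —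
the local index `c_p^{(p)} · #ℤ_p/((1/p) log_ω P)` of Castella 2018 (calcul) / JSW17 (7.1.5) read
under (iv) (`#H⁰(K_𝔭, E[p^∞]) = 1`). [cite: Castella2018, proof of Thm. 2.3, (calcul) (arXiv:1704.06608 p. 6)]
[cite: JetchevSkinnerWan2017, (7.1.5) (arXiv:1512.06894 p. 16)] -/
theorem index_range_nsmul_sup_zmultiples_padicPointOf_of_mult (hmult : Mult W p)
    (hiv : ∀ R : (W.baseChange ℚ_[p]).toAffine.Point, p • R = 0 → R = 0)
    (ι : K →+* ℚ_[p]) (P : (W.baseChange K).toAffine.Point)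
    (hP : ¬ IsOfFinAddOrder (padicPointOf W p ι P)) (k : ℕ) :
    ∃ e : ℕ, ((nsmulAddMonoidHom (p ^ k) : (W.baseChange ℚ_[p]).toAffine.Point →+ _).range ⊔
        AddSubgroup.zmultiples (padicPointOf W p ι P)).index = p ^ min k e ∧
      (e : ℤ) = padicLogOrd W p ι P +
        padicValNat p ((W.baseChange ℚ_[p]).localTamagawaNumber ℤ_[p]) - 1 := by
  obtain ⟨e, h1, h2⟩ := index_range_nsmul_sup_zmultiples_padicPointOf W p hiv ι P hP k
  refine ⟨e, h1, ?_⟩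
  rw [h2, padicValNat.eq_zero_of_not_dvd (LocalTorsion.not_dvd_reductionPointCount_of_mult W p hmult)]
  push_cast
  ring

end Global

end Summit.BirchSwinnertonDyer.Rank1Residual.X11b.LocalIndex

end
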